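import Summits.BirchSwinnertonDyer.BirchSwinnertonDyer.Theses.KatoDescentTamePotSupersingular
import Summits.BirchSwinnertonDyer.BirchSwinnertonDyer.Theorems.KatoDescentPotSupersingularReducibleKatoMemberOfCountValueInputsNodes
import HarnessLib

/-!
# Route `KatoDescentTamePotSupersingular` (rung K8-t′, cell `bsd-potss`): the crux `ReducibleKatoMember` (item
# stmt-BirchSwinnertonDyer-19196, shared with K9) AND the U₀-red crux `TameUpperReducibleDefect` FROM ONE PACKAGE — the
# value-guarded inputs WITH THE TWO PRINTED COUNTS at Kato's member — thin route-typed restatements of the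
# route-free node theorems of `Theorems.ReducibleOfCountValueInputs`

Seat `bsd-potss-rkm` generation 11.  The structure `Kato2004.MemberHullCountValueInputs` (Literature, this
seat: `MemberHullValueInputs` with the composite `count` replaced by kmc's printed counts (C1)/(C2); no named
fact) and the route-free kernel `Theorems/KatoDescentPotSupersingularReducibleKatoMemberOfCountValueInputsNodes.lean`
give both cruxes from the SAME `∀∃` shell (displayed as the hypothesis `h`; it is the text a planner's
optional consolidation resplit would file as ONE held child replacing `PublishedInputMemberHullZetaInputsT` and
`PublishedInputMemberHullCountInputsT (19707)`, net debt −1).  This file restates the two nodes with the route decls as types, in the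
binder order such a glue would use (each alias decl unfolds by `rfl` to the named fact ascribed below).
CONDITIONAL (audit `proof.conditional`); no item is closed.  HONEST FRAMING: BSD is not advanced; nothing is
booked; no trust base changes until a planner edit.

References: [Kato2004Asterisque] Thm. 12.6 (p. 222), §14.8 (p. 238), (14.9.3) (p. 240), §14.14 (p. 243),
Prop. 14.16 and its proof (pp. 244–245); [Wuthrich2014] Lemma 14; [GreenbergLNM1716] §3, app. to §4;
[Darmon2004] Thm. 3.22; [Cassels1965ArithmeticVIII].
-/

set_option autoImplicit false
set_option linter.dupNamespace false

noncomputable section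

open scoped NumberField TensorProduct
open Field IsDedekindDomain CongruenceSubgroup WeierstrassCurve
open Literature.NumberTheory.GaloisRepresentations
open Literature.NumberTheory.EllipticCurves Literature.NumberTheory.EllipticCurves.ModularForms
open Literature.NumberTheory.EllipticCurves.Kato2004
open Literature.NumberTheory.EllipticCurves.Kato2004.EulerSystemValues Rat.HeightOneSpectrum
open Literature.NumberTheory.EllipticCurves.IwasawaAlgebra

namespace Summit.BirchSwinnertonDyer.BirchSwinnertonDyer.Theorems

/-- **The K8-t′ crux `ReducibleKatoMember` (item stmt-BirchSwinnertonDyer-19196; type = the route decl verbatim)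
from the count-value shell**, in the glue order `PublishedInputNewformKato… → <count-value child> →
PublishedInputRankEqAnalyticRank… → ReducibleKatoMember`: `exists_isNewformOf → shell →
rank_eq_analyticRank_of_analyticRank_le_one → ReducibleKatoMember`, by
`ReducibleOfCountValueInputs.katoMemberShaBoundOfReducible_of_countValue`.  Conditional on the named facts;
the item is not closed by this theorem.
[cite: Kato2004Asterisque, Thm. 12.6 (p. 222), §14.14 and Lemma 14.15 (pp. 243–244), Prop. 14.16 (2) (p. 244)]
[cite: Wuthrich2014, Lemma 14 (p. 396)] [cite: Darmon2004, Thm. 3.22] -/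
theorem tameReducibleKatoMember_of_countValueInputs (hmod : exists_isNewformOf)
    (h : ∀ (W : WeierstrassCurve ℚ) [W.IsElliptic] [W.IsGloballyMinimal] (p : ℕ) [Fact p.Prime]
      (hp : p ≠ 2),
      ¬ W.HasGoodReductionAtPrime p → ¬ W.HasMultiplicativeReductionAtPrime p →
      0 ≤ padicValRat p W.j →
      ¬ W.HasIrreducibleModPGaloisRep p →
      W.entireLFunction 1 ≠ 0 → Finite W.sha →
      ∃ (W' : WeierstrassCurve ℚ) (_ : W'.IsElliptic) (_ : W'.IsGloballyMinimal),
        WeierstrassCurve.IsIsogenous W W' ∧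
        ∀ [ContinuousSMul ℤ_[p] (W'.tateModule p)] [Module.Free ℤ_[p] (W'.tateModule p)]
          [Module.Finite ℤ_[p] (W'.tateModule p)],
        ∀ {N : ℕ} [NeZero N] (f : CuspForm (Gamma0 N) 2), IsNewformOf W f →
        ∀ (ι : (m : ℕ) → (CyclotomicField m ℚ →+* ℂ)),
        ∃ (κ' : ℝ) (Λ' : ∀ (k : ℕ) (r : Finset (HeightOneSpectrum (𝓞 ℚ))),
            H1 (tateRep W' p) (cycSubgroup p k r) →ₗ[ℤ_[p]] ℚ_[p] ⊗[ℚ] CyclotomicField (cycLevel p k r) ℚ)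
          (c d a : ℤ) (A : ℕ)
          (z : ∀ (k : ℕ) (r : (cyclotomicLevelsRat p (badPlaces c d A N)).Ideals),
            H1 (tateRep W' p) ((cyclotomicLevelsRat p (badPlaces c d A N)).level k r.1))
          (x : ∀ (k : ℕ) (r : (cyclotomicLevelsRat p (badPlaces c d A N)).Ideals),
            CyclotomicField (cycLevel p k r.1) ℚ),
          κ' ≠ 0 ∧ 0 < A ∧ Int.gcd c (6 * p * A) = 1 ∧ Int.gcd d (6 * p * N) = 1 ∧
          Int.gcd (c * d) A = 1 ∧
          (∃ d' : ℤ, d * d' ≡ 1 [ZMOD (A : ℤ)] ∧ cuspFactor f true (fun _ ↦ 1) c d a A d' ≠ 0) ∧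
          ZetaBody W' p f ι κ' Λ' c d a A z x ∧
          ∀ (κ : ZpExtension ℚ p) (γ : absoluteGaloisGroup ℚ) (hκ : κ.IsCyclotomic),
            κ.IsTopGenerator γ →
            ∀ (I : IwasawaH1Data W' p κ γ) (y : I.H),
              (∀ n : ℕ, I.proj n y = levelToLayer W' p hκ hp (badPlaces c d A N) n
                (z (n + 1) (cyclotomicLevelsRat p (badPlaces c d A N)).idealOne)) →
              Nonempty (MemberHullCountValueInputs W' p κ γ I y))
    (hGZK : rank_eq_analyticRank_of_analyticRank_le_one) :
    Summit.BirchSwinnertonDyer.BirchSwinnertonDyer.Theses.KatoDescentTamePotSupersingular.ReducibleKatoMember :=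
  ReducibleOfCountValueInputs.katoMemberShaBoundOfReducible_of_countValue hmod h hGZK

/-- **The K8-t′ crux `TameUpperReducibleDefect` (type = the route decl verbatim) from the count-value shell**, in the
binder order of the existing glue `TameUpperReducibleDefectOfCountInputs` with the count child replaced by the shell:
`nonempty_iwasawaH1Data → exists_isNewformOf → shell → bsdRHS_eq_of_isIsogenous →
rank_eq_analyticRank_of_analyticRank_le_one → hasEntireLFunction_rat → TameUpperReducibleDefect` (the first hypothesis
is a theorem and is not used), by `ReducibleOfCountValueInputs.tameUpperReducibleDefect_body_of_countValue`.  Conditional on the named facts;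
the item is not closed by this theorem.
[cite: Kato2004Asterisque, proof of Prop. 14.16 (pp. 244–245), §14.14 (p. 243), Thm. 12.6 (p. 222)]
[cite: GreenbergLNM1716, §3 and appendix to §4] [cite: Cassels1965ArithmeticVIII] -/
theorem tameUpperReducibleDefect_of_countValueInputs (_hne : Kato2004.nonempty_iwasawaH1Data) (hmod : exists_isNewformOf)
    (h : ∀ (W : WeierstrassCurve ℚ) [W.IsElliptic] [W.IsGloballyMinimal] (p : ℕ) [Fact p.Prime]
      (hp : p ≠ 2),
      ¬ W.HasGoodReductionAtPrime p → ¬ W.HasMultiplicativeReductionAtPrime p →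
      0 ≤ padicValRat p W.j →
      ¬ W.HasIrreducibleModPGaloisRep p →
      W.entireLFunction 1 ≠ 0 → Finite W.sha →
      ∃ (W' : WeierstrassCurve ℚ) (_ : W'.IsElliptic) (_ : W'.IsGloballyMinimal),
        WeierstrassCurve.IsIsogenous W W' ∧
        ∀ [ContinuousSMul ℤ_[p] (W'.tateModule p)] [Module.Free ℤ_[p] (W'.tateModule p)]
          [Module.Finite ℤ_[p] (W'.tateModule p)],
        ∀ {N : ℕ} [NeZero N] (f : CuspForm (Gamma0 N) 2), IsNewformOf W f →
        ∀ (ι : (m : ℕ) → (CyclotomicField m ℚ →+* ℂ)),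
        ∃ (κ' : ℝ) (Λ' : ∀ (k : ℕ) (r : Finset (HeightOneSpectrum (𝓞 ℚ))),
            H1 (tateRep W' p) (cycSubgroup p k r) →ₗ[ℤ_[p]] ℚ_[p] ⊗[ℚ] CyclotomicField (cycLevel p k r) ℚ)
          (c d a : ℤ) (A : ℕ)
          (z : ∀ (k : ℕ) (r : (cyclotomicLevelsRat p (badPlaces c d A N)).Ideals),
            H1 (tateRep W' p) ((cyclotomicLevelsRat p (badPlaces c d A N)).level k r.1))
          (x : ∀ (k : ℕ) (r : (cyclotomicLevelsRat p (badPlaces c d A N)).Ideals),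
            CyclotomicField (cycLevel p k r.1) ℚ),
          κ' ≠ 0 ∧ 0 < A ∧ Int.gcd c (6 * p * A) = 1 ∧ Int.gcd d (6 * p * N) = 1 ∧
          Int.gcd (c * d) A = 1 ∧
          (∃ d' : ℤ, d * d' ≡ 1 [ZMOD (A : ℤ)] ∧ cuspFactor f true (fun _ ↦ 1) c d a A d' ≠ 0) ∧
          ZetaBody W' p f ι κ' Λ' c d a A z x ∧
          ∀ (κ : ZpExtension ℚ p) (γ : absoluteGaloisGroup ℚ) (hκ : κ.IsCyclotomic),
            κ.IsTopGenerator γ →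
            ∀ (I : IwasawaH1Data W' p κ γ) (y : I.H),
              (∀ n : ℕ, I.proj n y = levelToLayer W' p hκ hp (badPlaces c d A N) n
                (z (n + 1) (cyclotomicLevelsRat p (badPlaces c d A N)).idealOne)) →
              Nonempty (MemberHullCountValueInputs W' p κ γ I y))
    (hCassels : bsdRHS_eq_of_isIsogenous) (hGZK : rank_eq_analyticRank_of_analyticRank_le_one)
    (hmodL : hasEntireLFunction_rat) :
    Summit.BirchSwinnertonDyer.BirchSwinnertonDyer.Theses.KatoDescentTamePotSupersingular.TameUpperReducibleDefect :=
  ReducibleOfCountValueInputs.tameUpperReducibleDefect_body_of_countValue hmod h hCassels hGZK hmodL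

end Summit.BirchSwinnertonDyer.BirchSwinnertonDyer.Theorems

end
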